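import Summits.ABC.ABC.Theorems.AbcExplicitSocket
import HarnessLib

/-!
# An EXPLICIT constant for `log c ≤ κ · rad(abc)^6` (papers lane ABC-P1, writer seat; theorems only)

`Summits/ABC/ABC/Theorems/AbcExplicitRadPowSix.lean`.  Composition of the EXPLICIT forms of Theorem A
(`PadicCW77.symmBound_of_coreBound` + `packs_exist`: `C(m) = 2·Cw m`, envelope `c₁ = 2^70`, `c₂ = 1` by
`PadicW80Par.two_mul_Cw_le`), WP-M (`PrincipalLattice.exists_principal_generators`), the glue
(`primePadicBoundAt_odd_of_principal`: `K = 4704`, `L = 32c₁`, exponent `c₂ + 2`) and the written-out odd socket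
(`AbcExplicitSocket.lean`) into `abc_log_le_explicit_mul_rad_pow_six`: for every abc triple
`log c ≤ κ₆ · rad(abc)^6` with the closed-form real
`κ₆ = (3 + 3·240^4·(3·48·4704·80^4·(2^77 e^3)^⌈(2^77 e^3)^8⌉ + 1))^{24/23}` displayed in the statement — a tower
(`log₁₀ κ₆ ≈ 1.8·10^197`), recorded because it is the tree's first abc-type bound whose constant is a closed term
rather than an existential (`BakerShapeBound 6 0` = `bakerShapeBound_six_zero_oddSocket` is its `∃`-form); no
arithmetical use is claimed.  No new definition; [folklore] bookkeeping on landed theorems.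
-/

set_option linter.dupNamespace false

noncomputable section

open Finset Real
open Literature.NumberTheory.DiophantineGeometry
open Literature.Barriers.ABC

namespace Summit.ABC.ABC.Theorems

open Summit.ABC.StewartYu
open Literature.NumberTheory.Transcendental Literature.NumberTheory.Transcendental.PadicCW77 Height

/-- **The one-prime bound at every odd prime, with explicit constants** `(K, L, κ, σ, τ, τ₁) =
(4704, 32·2^70, 1+2, 2, 2, 2)`: Theorem A in explicit form (`CoreBound Cw 0` from `packs_exist`, `SymmBound (2·Cw) 0`
by `symmBound_of_coreBound`, envelope `c₁ = 2^70`, `c₂ = 1` by `two_mul_Cw_le`), WP-M (`exists_principal_generators`) and the glue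
`primePadicBoundAt_odd_of_principal`. [folklore] -/
theorem primePadicBound_odd_explicit {p : ℕ} (hp : p.Prime) (hp2 : p ≠ 2) (n : ℕ) (q : Fin n → ℕ)
    (e : Fin n → ℤ) (hq : ∀ i, (q i).Prime) (hinj : Function.Injective q) (hqp : ∀ i, q i ≠ p)
    (he : e ≠ 0) (hne1 : ∏ i, ((q i : ℚ)) ^ e i ≠ 1) :
    (padicValRat p (∏ i, ((q i : ℚ)) ^ e i - 1) : ℝ) ≤
      4704 * (32 * 2 ^ 70) ^ n * (n : ℝ) ^ (((1 : ℝ) + 2) * n) * (p : ℝ) ^ (2 : ℝ) * (∏ i, Real.log (q i)) *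
        Real.log (max 3 ((Finset.univ.sup fun i => (e i).natAbs : ℕ) : ℝ)) ^ 2 *
        Real.log (max 3 (∏ i, ((q i : ℕ) : ℝ))) ^ 2 := by
  classical
  -- Theorem A, explicit: the core bound with `C = Cw`, `r = 0`, from the packs
  have hcore : CoreBound PadicW80Par.Cw (fun _ => 0) := by
    intro S V Vθ Vmax W hK hμ hV hVθ hVp hVθp hVm hVθm hW hWθ
    rcases Nat.eq_zero_or_pos S.d with hd | hd
    · exact S.coreBound_of_d_zero hd (r := fun _ => 0) rfl (PadicW80Par.two_le_Cw le_rfl) V Vθ Vmax W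
        hVθ hVθp hVθm hWθ
    · obtain ⟨U, hU, ⟨pk⟩⟩ := packs_exist S V Vθ Vmax W hd hK hμ hV hVθ hVp hVθp hVm hVθm hW hWθ
      refine Setup.norm_Λ₀_gt_of_paramPack_le pk ?_
      rw [pow_zero, div_one]
      exact hU
  have hsymm := symmBound_of_coreBound (r := fun _ => 0) (fun _ hm => PadicW80Par.two_le_Cw hm)
    (fun _ => Nat.zero_le _) hcore
  set C' : ℕ → ℝ := fun m => if m = 0 then 1 else 2 * PadicW80Par.Cw m with hC'
  have hC : ∀ m, 0 ≤ C' m ∧ C' m ≤ (2 ^ 70 : ℝ) ^ m * (m : ℝ) ^ ((1 : ℝ) * m) := by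
    intro m
    by_cases hm : m = 0
    · subst hm; simp [hC']
    · simp only [hC', if_neg hm]
      have h1 := Nat.one_le_iff_ne_zero.mpr hm
      exact ⟨by linarith [PadicW80Par.two_le_Cw h1], PadicW80Par.two_mul_Cw_le h1⟩
  have hA : ∀ (p : ℕ), p.Prime → p ≠ 2 →
      ∀ (m : ℕ) (α : Fin m → ℚ) (b : Fin m → ℤ) (V : Fin m → ℝ) (Vmax W : ℝ),
        (∀ j, α j ≠ 0 ∧ 1 ≤ padicValRat p (α j - 1)) →
        (∀ μ : Fin m → ℤ, ∏ j, α j ^ μ j = 1 → μ = 0) →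
        (∀ T : Finset (Fin m), T.Nonempty → ¬ IsSquare (∏ j ∈ T, α j)) →
        (∀ j, logHeight₁ (α j) ≤ V j) → (∀ j, Real.log p ≤ V j) → (∀ j, V j ≤ Vmax) →
        b ≠ 0 → (∀ j, Real.log (max 3 (|b j| : ℝ)) ≤ W) →
        (padicValRat p (∏ j, α j ^ b j - 1) : ℝ) * Real.log p ≤
          C' m * (∏ j, V j) * (W + Real.log (2 * Vmax)) * Real.log (2 * Vmax) /
            Real.log p ^ ((fun _ : ℕ => 0) m) := by
    intro p hp hp2 m α b V Vmax W hα hmult hK hV hVp hVmax hb hW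
    by_cases hm : m = 0
    · subst hm; exact absurd (Subsingleton.elim b 0) hb
    · simp only [hC', if_neg hm]
      exact hsymm p hp hp2 m α b V Vmax W hα hmult hK hV hVp hVmax hb hW
  exact primePadicBoundAt_odd_of_principal (C := C') (r := fun _ => 0) (c₁ := 2 ^ 70) (c₂ := 1)
    PrincipalLattice.exists_principal_generators (by norm_num) hC hA hp hp2 n q e hq hinj hqp he hne1

/-- **`log c ≤ κ₆ · rad(abc)^6` for every abc triple, RAW explicit form**: the odd socket run on
`primePadicBound_odd_explicit` (`θ = κ + σ + 1 = (1+2) + 2 + 1`); the constant is the socket's closed form at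
`(K, L, κ, σ, τ, τ₁) = (4704, 32·2^70, 1+2, 2, 2, 2)`. [folklore] -/
theorem abc_log_le_explicit_mul_rad_pow_six_raw (a b c : ℕ) (ht : IsABCTriple a b c) :
    Real.log c ≤
      (3 + (3 * (48 * (4704 : ℝ) * ((4 * (32 * 2 ^ 70) * Real.exp (1 + 2)) ^
              ⌈(4 * (32 * 2 ^ 70 : ℝ) * Real.exp (1 + 2)) ^ (1 / (1 / 8 : ℝ))⌉₊) *
            (16 * (((2 + 2 : ℕ) : ℝ) + 1)) ^ (2 + 2)) + 1) *
          ((((2 + 2 : ℕ) : ℝ) + 1) / (1 / (8 * ((1 + 2) + 2 + 1 : ℝ)))) ^ (2 + 2) * 3) ^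
        (1 / (1 - 2 * (1 / (8 * ((1 + 2) + 2 + 1 : ℝ))))) *
      (rad a b c : ℝ) ^ ((1 + 2) + 2 + 1 : ℝ) :=
  log_le_explicit_of_oddPrime_logRadShape (K := 4704) (L := 32 * 2 ^ 70) (κ := 1 + 2) (σ := 2) (τ := 2)
    (τ₁ := 2) (by norm_num) (by norm_num) (by norm_num) (by norm_num)
    (fun p hp hp2 n q e hq hinj hqp he hne1 => primePadicBound_odd_explicit hp hp2 n q e hq hinj hqp he hne1)
    a b c ht

/-- **`log c ≤ κ₆ · rad(abc)^6` for every abc triple, with the EXPLICIT constant**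
`κ₆ = (3 + 3·240^4·(3·48·4704·80^4·(2^77 e^3)^⌈(2^77 e^3)^8⌉ + 1))^{24/23}` (a tower: `log₁₀ κ₆ ≈ 1.8·10^197`).
This is the first abc-type bound of the tree whose constant is a closed term rather than an existential; it is not claimed to be of
any arithmetical use. [folklore] -/
theorem abc_log_le_explicit_mul_rad_pow_six (a b c : ℕ) (ht : IsABCTriple a b c) :
    Real.log c ≤
      (3 + 3 * 240 ^ 4 *
          (3 * (48 * 4704 * 80 ^ 4 * ((2 : ℝ) ^ 77 * Real.exp 3) ^ ⌈((2 : ℝ) ^ 77 * Real.exp 3) ^ (8 : ℝ)⌉₊) + 1)) ^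
        (24 / 23 : ℝ) * (rad a b c : ℝ) ^ (6 : ℝ) := by
  have h := abc_log_le_explicit_mul_rad_pow_six_raw a b c ht
  have e1 : (4 * (32 * 2 ^ 70 : ℝ) * Real.exp (1 + 2)) = (2 : ℝ) ^ 77 * Real.exp 3 := by norm_num
  have e2 : (1 / (1 / 8 : ℝ)) = 8 := by norm_num
  have e3 : (((2 + 2 : ℕ) : ℝ) + 1) = 5 := by norm_num
  have e4 : ((1 + 2) + 2 + 1 : ℝ) = 6 := by norm_num
  rw [e1, e2, e3, e4] at h
  convert h using 2
  norm_num
  ring_nf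

/-- **Hence `log c ≤ κ₆ · rad(abc)^{15}`** with the SAME explicit constant (`rad ≥ 1`): the Stewart–Tijdeman 1986 shape
`BakerShapeBound 15 0` with a closed-term constant. [cite: StewartTijdeman1986, Theorem 1 (upper bound), as quoted in
Waldschmidt2014 §2] -/
theorem abc_log_le_explicit_mul_rad_pow_fifteen (a b c : ℕ) (ht : IsABCTriple a b c) :
    Real.log c ≤
      (3 + 3 * 240 ^ 4 *
          (3 * (48 * 4704 * 80 ^ 4 * ((2 : ℝ) ^ 77 * Real.exp 3) ^ ⌈((2 : ℝ) ^ 77 * Real.exp 3) ^ (8 : ℝ)⌉₊) + 1)) ^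
        (24 / 23 : ℝ) * (rad a b c : ℝ) ^ (15 : ℝ) := by
  have h := abc_log_le_explicit_mul_rad_pow_six a b c ht
  have hR : (1 : ℝ) ≤ (rad a b c : ℝ) := one_le_rad_real a b c
  refine h.trans (mul_le_mul_of_nonneg_left (Real.rpow_le_rpow_of_exponent_le hR (by norm_num)) ?_)
  positivity

end Summit.ABC.ABC.Theorems

end
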